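/-
Copyright: the b2b-balaban T⁴-continuum CRUX team, row NE7b OWNER lineage `t4-ne7b-p1` (gen 105). Project licence.
-/
import Summits.QuantumFields.BalabanUV.T4Continuum.Spine.NE7b.GaussianDominatedMoment

/-!
# `LocCondStability` from a carrier bound ON THE SUPPORT OF THE PINNED TERM («small-field backgrounds only»)
# (row NE7b, node U5c; the junction of `…NE7b.GaussianDominatedMoment` §3 sharpened to print's form)

Cell `pub-balaban`, sub-cell `t4`, spine estimate NE7b (`T4WeightBudget.RelWeightBound`; the cell's OWN estimate — NOT PRINTED in
[Bałaban 1983–89], NOT PROVED).  Crux-route work under `Spine/NE7b/` by the row's OWNER; NOTHING of Bałaban's is named or asserted;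
no `T4Continuum/Support` leaf typed; zero `sorry`.

WHY.  `GaussianDominatedMoment.locCondStability_of_carrier_le` asks the carrier bound `M j g y ≤ e^{b j g}` for EVERY background `y`.
That is more than print uses and more than is true for Bałaban's kernels: the located obstruction
`LocalConditionalStability.gaussian_partial_moment_shift` shows the Gaussian moment is background-uniform ONLY for small-field
backgrounds, and [Balaban1989LargeFieldI] p. 177 says the quotients are «determined by small field effective actions only».  On the
road this is harmless because the pinned TERM `eterm j g` already carries the characteristic functions of the history `g`: it
VANISHES off the backgrounds the history declared small (outside its recorded large-field regions).  THIS FILE proves the junction in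
exactly that form: a carrier bound on the SUPPORT of the term suffices — `M j g y ≤ e^{b j g}` is asked only where `eterm j g y ≠ 0`
(integrability conjunct included, by truncating the carrier at `e^{b}` off the support, which changes nothing under the integral).

WHAT IS PROVED ([folklore]): `mul_eq_min_mul` (truncation off the support is invisible against the term),
**`locCondStability_of_carrier_le_on_support`**, and its packaging with a background-dependent Gaussian carrier
**`locCondStability_of_gaussianCarrier_on_support`** (the data `S j g y, Q j g y` need be dominated ∕ of rank `≤ r` only on the
support of the term; exponent `b j g = r j g · (−log(1−δ)∕2)`).

NOT HERE (honest): anything of Bałaban's (which backgrounds ARE small-field on the support of his terms is the (A1c) instance's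
reading, NC-NE7b-α UNRULED).  NE7b NOT PRINTED ∕ NOT PROVED; spine PROVED 0∕9; rung (B)+1 on a FINITE torus — NOT infinite volume,
NOT the mass gap, NOT Clay.
HONEST DEPENDENCY: continuum YM on T⁴ ⇐ BetaPertH ∧ nine spine estimates (0/9 proved); BetaPertH ⇐ (D1) ∧ (D4) ∧ CAP+tail.
-/

set_option autoImplicit false

open Matrix Finset MeasureTheory Real
open Summit.QuantumFields.BalabanUV.T4Continuum.B16HistoryIndexedRepr Summit.QuantumFields.BalabanUV.T4Continuum.B16HistoryReprChain
open Summit.QuantumFields.BalabanUV.T4Continuum.NE7b.PrefixExtraction Summit.QuantumFields.BalabanUV.T4Continuum.NE7b.LocalConditionalStability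
open Summit.QuantumFields.BalabanUV.T4Continuum.NE7b.GaussianDominatedMoment

namespace Summit.QuantumFields.BalabanUV.T4Continuum.NE7b.CarrierOnSupport

/-- Truncating a factor at a level it does not exceed on the support of the other factor changes nothing:
`M·e = min(M, c)·e` when `e y ≠ 0 ⟹ M y ≤ c`. [folklore] -/
theorem mul_eq_min_mul {X : Type*} (M e : X → ℝ) (c : ℝ) (h : ∀ y, e y ≠ 0 → M y ≤ c) (y : X) :
    M y * e y = min (M y) c * e y := by
  by_cases he : e y = 0
  · rw [he, mul_zero, mul_zero]
  · rw [min_eq_left (h y he)]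

variable {P : Type} [DecidableEq P] {C : ℕ → Type} {𝒢 : (j : ℕ) → GoodClass (C j)}

/-- **LCS FROM A CARRIER BOUND ON THE SUPPORT OF THE TERM.**  On a history tower with integrable terms, a non-negative,
a.e.-strongly measurable moment carrier with `M j g y ≤ e^{b j g}` WHEREVER THE PINNED TERM IS NON-ZERO (at the pattern prefixes of
the levels `j < K`) inhabits `LocCondStability T S K μ ρ₀ M b`, integrability conjunct included.  Backgrounds off the support — the
large-field backgrounds the history excluded — are not asked anything. [folklore] -/
theorem locCondStability_of_carrier_le_on_support (T : Tower P C 𝒢) (S : (j : ℕ) → (Fin j → P) → Finset P) (K : ℕ)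
    [∀ j, MeasurableSpace (C j)] (μ : (j : ℕ) → Measure (C j)) (ρ₀ : C 0 → ℝ) (M : (j : ℕ) → (Fin j → P) → C j → ℝ)
    (b : (j : ℕ) → (Fin j → P) → ℝ) (hρ : (𝒢 0).Gd ρ₀) (h0 : ∀ x, 0 ≤ ρ₀ x)
    (hMm : ∀ j g, j < K → g ∈ admS T S j → AEStronglyMeasurable (M j g) (μ j))
    (hM0 : ∀ j g, j < K → g ∈ admS T S j → ∀ y, 0 ≤ M j g y)
    (hMb : ∀ j g, j < K → g ∈ admS T S j → ∀ y, T.eterm ρ₀ j g y ≠ 0 → M j g y ≤ exp (b j g))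
    (hint : ∀ j g, j < K → g ∈ admS T S j → Integrable (T.eterm ρ₀ j g) (μ j)) :
    LocCondStability T S K μ ρ₀ M b := by
  intro j g hj hg
  -- the truncated carrier `min M e^{b}` is bounded, measurable, and gives the same product
  have heq : (fun y => M j g y * T.eterm ρ₀ j g y) = fun y => min (M j g y) (exp (b j g)) * T.eterm ρ₀ j g y :=
    funext fun y => mul_eq_min_mul (M j g) (T.eterm ρ₀ j g) (exp (b j g)) (hMb j g hj hg) y
  have hMe : Integrable (fun y => min (M j g y) (exp (b j g)) * T.eterm ρ₀ j g y) (μ j) :=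
    (hint j g hj hg).bdd_mul
      ((continuous_id.min continuous_const).comp_aestronglyMeasurable (hMm j g hj hg) :
        AEStronglyMeasurable (fun y => min (M j g y) (exp (b j g))) (μ j))
      (Filter.Eventually.of_forall fun y => by
        rw [Real.norm_eq_abs, abs_of_nonneg (le_min (hM0 j g hj hg y) (exp_pos _).le)]
        exact min_le_right _ _)
  rw [heq]
  refine ⟨hMe, ?_⟩
  calc ∫ y, min (M j g y) (exp (b j g)) * T.eterm ρ₀ j g y ∂μ j ≤ ∫ y, exp (b j g) * T.eterm ρ₀ j g y ∂μ j :=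
        integral_mono hMe ((hint j g hj hg).const_mul _) fun y =>
          mul_le_mul_of_nonneg_right (min_le_right _ _) (T.eterm_nonneg hρ h0 j g y)
    _ = exp (b j g) * ∫ y, T.eterm ρ₀ j g y ∂μ j := integral_const_mul _ _

variable {n : Type*} [Fintype n] [DecidableEq n]

/-- **LCS FOR A BACKGROUND-DEPENDENT GAUSSIAN CARRIER, ON THE SUPPORT.**  If at every pattern prefix of a level `j < K` the carrier
IS the normalised Gaussian moment of the background-dependent data — `M j g y = (∫ e^{zᵀ(Q j g y)z} e^{−zᵀ(S j g y)z} dz) ∕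
(∫ e^{−zᵀ(S j g y)z} dz)` with `S j g y` positive definite and `Q j g y` positive semidefinite for every `y` — and ON THE SUPPORT OF
THE TERM the sacrificed form is `δ`-dominated of rank `≤ r j g` (`0 ≤ δ < 1`; nothing is asked off the support), then
`LocCondStability T S K μ ρ₀ M b` holds with `b j g = r j g · (−log(1−δ)∕2)`. [folklore] -/
theorem locCondStability_of_gaussianCarrier_on_support (T : Tower P C 𝒢) (Spat : (j : ℕ) → (Fin j → P) → Finset P) (K : ℕ)
    [∀ j, MeasurableSpace (C j)] (μ : (j : ℕ) → Measure (C j)) (ρ₀ : C 0 → ℝ) (M : (j : ℕ) → (Fin j → P) → C j → ℝ)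
    (S Q : (j : ℕ) → (Fin j → P) → C j → Matrix n n ℝ) (r : (j : ℕ) → (Fin j → P) → ℕ) {δ : ℝ}
    (hρ : (𝒢 0).Gd ρ₀) (h0 : ∀ x, 0 ≤ ρ₀ x) (hδ0 : 0 ≤ δ) (hδ : δ < 1)
    (hM : ∀ j g, j < K → g ∈ admS T Spat j → ∀ y, M j g y =
      (∫ z, exp (z ⬝ᵥ (Q j g y *ᵥ z)) * exp (-(z ⬝ᵥ (S j g y *ᵥ z)))) / (∫ z, exp (-(z ⬝ᵥ (S j g y *ᵥ z)))))
    (hMm : ∀ j g, j < K → g ∈ admS T Spat j → AEStronglyMeasurable (M j g) (μ j))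
    (hS : ∀ j g, j < K → g ∈ admS T Spat j → ∀ y, (S j g y).PosDef)
    (hQ : ∀ j g, j < K → g ∈ admS T Spat j → ∀ y, (Q j g y).PosSemidef)
    (hdom : ∀ j g, j < K → g ∈ admS T Spat j → ∀ y, T.eterm ρ₀ j g y ≠ 0 → (δ • S j g y - Q j g y).PosSemidef)
    (hr : ∀ j g, j < K → g ∈ admS T Spat j → ∀ y, T.eterm ρ₀ j g y ≠ 0 → (Q j g y).rank ≤ r j g)
    (hint : ∀ j g, j < K → g ∈ admS T Spat j → Integrable (T.eterm ρ₀ j g) (μ j)) :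
    LocCondStability T Spat K μ ρ₀ M (fun j g => r j g * (-Real.log (1 - δ) / 2)) := by
  refine locCondStability_of_carrier_le_on_support T Spat K μ ρ₀ M _ hρ h0 hMm (fun j g hj hg y => ?_)
    (fun j g hj hg y hy => ?_) hint
  · rw [hM j g hj hg y]
    exact div_nonneg (integral_nonneg fun z => mul_nonneg (exp_pos _).le (exp_pos _).le)
      (integral_exp_neg_qf_pos (hS j g hj hg y)).le
  · rw [hM j g hj hg y, ← inv_sqrt_pow_eq_exp hδ]
    exact gaussianMoment_le_of_dominated (hS j g hj hg y) (hQ j g hj hg y) (hdom j g hj hg y hy) hδ0 hδ (hr j g hj hg y hy)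

end Summit.QuantumFields.BalabanUV.T4Continuum.NE7b.CarrierOnSupport
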